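import Literature.AlgebraicGeometry.Modules.RankOneCocycleIso
import Literature.AlgebraicGeometry.Modules.PullbackFrame
import Literature.AlgebraicGeometry.Modules.VectorBundleFiniteLocallyFree
import HarnessLib

/-!
# The determinant class is an isomorphism invariant; rank-one modules are classified by it
# (Hartshorne II Ex. 6.11, III Ex. 4.5)

Layer `Literature/AlgebraicGeometry/Modules`, namespace `Literature.AlgebraicGeometry.Modules`.
THEOREMS ONLY (no definition, no named fact, no instance).

The tree's determinant class `detClass hE : CechPic X = Ȟ¹(X, 𝒪_X^×)` of a finite locally free
`𝒪_X`-module (`Modules/DeterminantCocycle`: the cocycle `det T(e_x, e_y)` of a frame system, independent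
of the frames by `FrameSystem.cocycle_equiv`) was so far only known to be independent of the PROOF
of local freeness (`detClass_congr`). This file proves that it is an invariant of the ISOMORPHISM
CLASS of the module, and that in rank one it is a complete invariant:

* `transition_trans_mapIso` — transporting two frames `e : 𝒪^I ≅ E|_W`, `e' : 𝒪^{I'} ≅ E|_{W'}`
  along `φ : E ≅ E'` (`e ≫ φ|_W`) does not change the transition matrix `T(e, e')` (the basis
  sections become `φ(b_i)`, the coordinates are read through `φ⁻¹`: `basisSection_trans`,
  `dualBasis_trans`, `coord_trans`), hence not the determinant cocycle (`transitionDet_trans_mapIso`);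
* `detClass_eq_of_iso` — **`E ≅ E' ⟹ [det E] = [det E']`** (Hartshorne II Ex. 6.11: `det` is defined
  on isomorphism classes);
* `nonempty_iso_iff_detClass_eq` — **two modules of rank one are isomorphic iff their classes in
  `Ȟ¹(X, 𝒪_X^×)` agree** (Hartshorne III Ex. 4.5, `Pic X ≅ Ȟ¹(X, 𝒪_X^×)`; the converse direction is the
  tree's `nonempty_iso_of_cocycle_equiv`);
* `hasRank_of_iso`, `HasRank.isFiniteLocallyFree'`, `hasRank_pullback` — bookkeeping (rank is an
  isomorphism invariant, gives finite local freeness, and is preserved by pull-back, via the tree's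
  `FrameSystem.pullback`).

## References

* R. Hartshorne, *Algebraic Geometry*, GTM 52 (1977), II Ex. 5.16, II Ex. 6.11, III Ex. 4.5.
  [Hartshorne1977]
-/

noncomputable section

open CategoryTheory AlgebraicGeometry Opposite TopologicalSpace

universe u


namespace Literature.AlgebraicGeometry.Modules

open Literature.AlgebraicGeometry.Motives

section Frames

variable {X : Scheme.{u}} {E E' M : X.Modules} {W W' V : X.Opens} {I I' : Type u}

/-- Basis sections of a frame followed by an isomorphism of restricted modules are the images of
the basis sections. [folklore] -/
private theorem basisSection_trans (e : SheafOfModules.free I ≅ E.over W) (ψ : E.over W ≅ M.over W) (i : I) :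
    basisSection (e ≪≫ ψ) i = appLE ψ.hom (𝟙 W) (basisSection e i) := by
  unfold basisSection
  rw [Iso.trans_hom, SheafOfModules.freeHomEquiv_comp_apply, overSectionsEquiv_sectionsMap']

/-- The dual basis of a transported frame is the dual basis precomposed with the inverse
isomorphism. [folklore] -/
private theorem dualBasis_trans (e : SheafOfModules.free I ≅ E.over W) (ψ : E.over W ≅ M.over W) (i : I) :
    dualBasis (e ≪≫ ψ) i = ψ.inv ≫ dualBasis e i := by
  unfold dualBasis homOfBasisValues
  rw [Iso.trans_inv, Category.assoc]

/-- Coordinates in a transported frame are the coordinates of the preimage. [folklore] -/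
private theorem coord_trans (e : SheafOfModules.free I ≅ E.over W) (ψ : E.over W ≅ M.over W) (k : V ⟶ W)
    (s : Γ(M, V)) (i : I) : coord (e ≪≫ ψ) k s i = coord e k (appLE ψ.inv k s) i := by
  rw [coord_def, coord_def, dualBasis_trans, appLE_comp]

/-- **Transition matrices are invariant under an isomorphism of modules**: transporting two frames
of `E` along `φ : E ≅ E'` does not change their transition matrix (Görtz–Wedhorn I, (11.6) and
Prop. 11.15: isomorphic locally free modules have cohomologous — here equal — cocycles in
`Ȟ¹(𝒰, GL_n(𝒪_X))`). [cite: GortzWedhorn2020, Prop. 11.15 and Rem. 11.16 (pp. 365–369)] -/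
theorem transition_trans_mapIso (φ : E ≅ E') (e : SheafOfModules.free I ≅ E.over W)
    (e' : SheafOfModules.free I' ≅ E.over W') (k : V ⟶ W) (k' : V ⟶ W') :
    transition (e ≪≫ (SheafOfModules.overFunctor _ W).mapIso φ)
      (e' ≪≫ (SheafOfModules.overFunctor _ W').mapIso φ) k k' = transition e e' k k' := by
  ext i j
  rw [transition_apply, transition_apply, coord_trans, basisSection_trans, Functor.mapIso_inv,
    Functor.mapIso_hom, appLE_over_map, appLE_over_map, ← Scheme.Modules.Hom.app_map_apply]
  congr 1
  rw [← ConcreteCategory.comp_apply, ← Scheme.Modules.Hom.comp_app, Iso.hom_inv_id,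
    Scheme.Modules.Hom.id_app]
  rfl

/-- The determinants of the transition matrices are invariant under an isomorphism of modules.
[cite: GortzWedhorn2020, Prop. 11.15 and Rem. 11.16 (pp. 365–369)] [cite: Hartshorne1977, II Ex. 5.16] -/
theorem transitionDet_trans_mapIso (φ : E ≅ E') (e : SheafOfModules.free I ≅ E.over W)
    (e' : SheafOfModules.free I' ≅ E.over W') {n n' : ℕ} (ε : I ≃ Fin n) (ε' : I' ≃ Fin n')
    (k : V ⟶ W) (k' : V ⟶ W') :
    transitionDet (e ≪≫ (SheafOfModules.overFunctor _ W).mapIso φ)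
      (e' ≪≫ (SheafOfModules.overFunctor _ W').mapIso φ) ε ε' k k' = transitionDet e e' ε ε' k k' := by
  unfold transitionDet stdTransition
  rw [transition_trans_mapIso]

end Frames

section DetClass

variable {X : Scheme.{u}} {E E' : X.Modules}

/-- A module isomorphic to a module of rank `r` has rank `r` (the rank of a locally free module is
an invariant of its isomorphism class). [cite: Hartshorne1977, II.5 (locally free sheaves of rank n, p. 109)]
[cite: StacksProject, Tag 01C6 (Modules, Def. 17.14.1)] -/
theorem hasRank_of_iso (φ : E ≅ E') {r : ℕ} (hE : HasRank E r) : HasRank E' r := by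
  obtain ⟨F, hF⟩ := exists_frameSystem_of_hasRank hE
  exact FrameSystem.hasRank
    { U := F.U, mem := F.mem, I := F.I, rank := F.rank, enum := F.enum,
      frame := fun x => F.frame x ≪≫ (SheafOfModules.overFunctor _ (F.U x)).mapIso φ } r hF

/-- A module of rank `r` is finite locally free (Stacks, Tag 01C6: Def. 17.14.1 (2) with finite index
sets). [cite: StacksProject, Tag 01C6 (Modules, Def. 17.14.1 (2))] -/
theorem HasRank.isFiniteLocallyFree' {r : ℕ} (hE : HasRank E r) : IsFiniteLocallyFree E := by
  obtain ⟨F, -⟩ := exists_frameSystem_of_hasRank hE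
  exact F.isFiniteLocallyFree

/-- **The determinant class is an isomorphism invariant**: `E ≅ E' ⟹ [det E] = [det E']` in
`Ȟ¹(X, 𝒪_X^×)` (transport the frames along the isomorphism; the transition matrices do not
change). [cite: Hartshorne1977, II Ex. 6.11] -/
theorem detClass_eq_of_iso (φ : E ≅ E') (hE : IsFiniteLocallyFree E) (hE' : IsFiniteLocallyFree E') :
    detClass hE = detClass hE' := by
  classical
  let F := frameSystemOfIsFiniteLocallyFree hE
  let F' : FrameSystem E' :=
    { U := F.U, mem := F.mem, I := F.I, rank := F.rank, enum := F.enum,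
      frame := fun x => F.frame x ≪≫ (SheafOfModules.overFunctor _ (F.U x)).mapIso φ }
  rw [detClass_eq_mk hE F, detClass_eq_mk hE' F']
  exact CechPic.sound (UnitCocycle.equiv_of_eq _ _ F.U F.mem (fun _ => le_rfl) (fun _ => le_rfl)
    fun x y V hx hy => transitionDet_trans_mapIso φ (F.frame x) (F.frame y) (F.enum x) (F.enum y)
      (homOfLE hx) (homOfLE hy))

/-- **Two rank-one modules are isomorphic iff their determinant classes agree** (`Pic X ≅
Ȟ¹(X, 𝒪_X^×)` is injective, Hartshorne III Ex. 4.5; the classes may be computed from any proofs of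
local freeness). [cite: Hartshorne1977, III Ex. 4.5] -/
theorem nonempty_iso_iff_detClass_eq (h₁ : HasRank E 1) (h₁' : HasRank E' 1)
    (hE : IsFiniteLocallyFree E) (hE' : IsFiniteLocallyFree E') :
    Nonempty (E ≅ E') ↔ detClass hE = detClass hE' := by
  refine ⟨fun ⟨φ⟩ => detClass_eq_of_iso φ hE hE', fun h => ?_⟩
  obtain ⟨F, hF⟩ := exists_frameSystem_of_hasRank h₁
  obtain ⟨F', hF'⟩ := exists_frameSystem_of_hasRank h₁'
  rw [detClass_eq_mk hE F, detClass_eq_mk hE' F'] at h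
  exact nonempty_iso_of_cocycle_equiv F F' hF hF' h

/-- The rank of a module is preserved by pull-back (the pull-back of a locally free module of rank
`r` is locally free of rank `r`). [cite: StacksProject, Tag 01C8 (Modules, Lemma 17.14.3)] -/
theorem hasRank_pullback {Y : Scheme.{u}} (f : Y ⟶ X) {r : ℕ} (hE : HasRank E r) :
    HasRank ((Scheme.Modules.pullback f).obj E) r := by
  obtain ⟨F, hF⟩ := exists_frameSystem_of_hasRank hE
  exact (F.pullback f).hasRank r fun y => by rw [FrameSystem.pullback_rank]; exact hF _

end DetClass

end Literature.AlgebraicGeometry.Modules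

end
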